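import Summits.HodgeConjecture.HodgeConjecture.Theorems.Ring2AbelianAllAndreLefschetz
import Summits.HodgeConjecture.HodgeConjecture.Theorems.Ring2DeformCMPointedPencils
import Summits.HodgeConjecture.HodgeConjecture.Theorems.Ring2ClassTargets
import HarnessLib

/-!
# Ring 2 · sub-cell AbelianAll — the FRAME: the grammar of "`HC(all AV) ⇐ HC_CM` + ONE named statement `B`",
# its least element (the item `CMToAbelian`), the collapse of all exact complements modulo `HC_CM`, and the
# candidate ladder of the sub-cell instantiated BY NAME (deform IV/VI, hypotheses I, AbelianAll André I/II)

HONEST FRAMING (page 1, verbatim): **research route, not a corollary; conditional on HC_CM plus one named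
minimal statement.** Cell line: research route conditional on HC_CM; not a corollary; Q11.4-sentence-2
already refuted in dim ≥ 3. Nothing in this file proves a case of the Hodge conjecture; no statement minted in
the cell is cited as a fact; every OPEN node below is somebody's `@[conjecture]` def used as a HYPOTHESIS, and
the two printed inputs that occur (André 1996 Lemme 6.3.1, Lemmes 6.3.2–6.3.3) enter as the literature seat's
NAMED FACTS `andre1996_cmAnchoredPencil` (`h₂₁`) / `andre1996_cmHodgeClasses_algebraicallyAnchoredPencils`
(`h₂₂`), binders wherever used. Seat `pub-hodge-ring2-typer1` (statement layer; cell LEAD), gen 8.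

Bindings (the cell's, by name): `HC_CM` := `Theses.RankFourFaces.CMAbelianHodge` (item stmt-HodgeConjecture-3052;
a BINDER, never a fact); `HC_AV` := `Theses.PadicSemiregularLift.HodgeAbelianVarieties` (stmt-1333);
`CMToAbelian` := `Theses.RankFourFaces.CMToAbelian` = `HC_CM → ∀ A, IsSmoothProjective A.dim A.X →
HodgeConjectureFor A.dim A.X` (stmt-16267, OPEN; nothing here closes it).

## §0 The grammar (four predicates on a candidate `B : Prop`; definitions, nothing asserted)

* `ClosesWithCM B`  := `HC_CM → B → HC_AV`      — `B` is a SUFFICIENT complement of `HC_CM`;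
* `OnPathAV B`      := `HC_AV → B`              — `B` is NECESSARY (a consequence of the target; on-path);
* `ExactWithCM B`   := `HC_AV ↔ HC_CM ∧ B`      — both (`exactWithCM_iff`);
* `CMIdle B`        := `B → HC_AV`              — `B` alone already gives the target: next to such a `B` the
  hypothesis `HC_CM` is DECORATIVE (the honest column "KIND 1" of deform IV/VI and André I, as a predicate);
* `ModCM B`         := `HC_CM → B`              — the `HC_CM`-relativisation of `B`.

## §1 What the grammar proves by itself (kernel, unconditional, no literature input)

(a) ORDER: `ClosesWithCM` is antitone and `OnPathAV` monotone along implication; `CMIdle B → ClosesWithCM B`.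
(b) LEAST ELEMENT: `ClosesWithCM B ↔ (B → CMToAbelian)` (`closesWithCM_iff_imp_cmToAbelian`) and
    `ExactWithCM CMToAbelian` — so among ALL sufficient complements of `HC_CM` the route item `CMToAbelian` is the
    WEAKEST, and it is itself exact. This is the precise sense in which "the minimal `B`" exists (REFEREE-AB
    F-ab-4: no CANDIDATE is called minimal; the minimum of the whole preorder is the item, trivially).
(c) COLLAPSE MODULO `HC_CM`: any two exact complements are equivalent under `HC_CM`
    (`iff_of_exactWithCM_of_HC_CM`), and for every exact `B`, `ModCM B ↔ CMToAbelian`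
    (`modCM_iff_cmToAbelian_of_exactWithCM`): relativised to `HC_CM` there is exactly ONE complement. Hence the
    only meaningful order on candidates is UNCONDITIONAL implication (§3), and the informative bit per candidate
    is the pair (is it `OnPathAV`? is it `CMIdle` modulo print?).
(d) CLASS AXIS: `ClosesWithCM B ↔ (B → ∀ 𝒞, HC_CM → Ring2.ClassTargets.HCOnClass 𝒞)` — a sufficient complement
    closes every class target of the atlas axis under `HC_CM` (typer1's `Ring2ClassTargets` §4).

## §2 The candidate ladder instantiated BY NAME (one-liners over landed theorems; numbering REFEREE-AB R-01 (iii))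

| node `B` (tree decl) | `ClosesWithCM` | `OnPathAV` | `CMIdle` (kernel) | owner |
|---|---|---|---|---|
| `VHC` = `Theses.AnchorTransport.VariationalHodge` (item 1076) | mod `h₂₁` (here) or mod `MumfordTateCMAnchors` (hypotheses I) | NO from `HC_AV` (from the summit only, `Hypotheses.vhc_of_hodgeConjecture`) | mod `h₂₁ h₂₂` | hypotheses I |
| `FlatSectionsAlgebraic` (`Ring2.Hypotheses`) | via `VHC` | from the summit only | mod `h₂₁ h₂₂` | hypotheses I |
| (1) `Ring2.Hypotheses.AbelianSchemeVHC` | mod `MumfordTateCMAnchors` or mod `h₂₁` | yes | mod `h₂₁ h₂₂` | hypotheses I / deform I |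
| (2) `Ring2.Deform.CompactAbelianPencilVHC` | mod `h₂₁` | yes | mod `h₂₁ h₂₂` | deform IV |
| (L∀) `AlgebraicFixedPart` | mod `h₂₁` | not known (cycle-theoretic) | mod `h₂₁ h₂₂` | André I |
| (3) `Ring2.Deform.CMPointedCompactPencilVHC` ≡ `CMPointedPencilVHC` (`cmPointedPencilVHC_iff_deform`: COUNT ONCE) | mod `h₂₁` | yes | only mod deform VI's junction `J₂₂⁺` (local notation there; not restated) | deform VI ≡ André I |
| (R631) `Ring2.Deform.CMAnchoredPencilVHC` | mod `h₂₁` | yes | only mod `J₂₂⁺` | deform VI |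
| (4) `CMAnchoredTransport` | mod `h₂₁` (`HC_AV_of_HC_CM_and_Bmin`) | yes | not in kernel; in PRINT yes ([KuM91] CM anchors, André I honest column) | André I |
| (L) `CMFibreAlgebraicLift` | mod `h₂₁` | not known (cycle-theoretic) | not known | André I |
| (T∃) `CMAnchoredPencilTransport` | NO FACT | mod `h₂₁` | not known, in print NOT known either | André II |
| `CMToAbelian` (the item) | yes | yes | no | route RankFourFaces |

Rows (5)/(5∀) (`LefschetzBCMPointedPencils` / `LefschetzBCompactPencils`, André II §D) run through Milne 2020
Prop. 1, which is a local HYPOTHESIS SHAPE there (`Milne2020Prop1[]`, not yet a named fact, request R-ab-2): they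
are not instantiated here; see `AbelianAll.chain`. The Weil column (ab-weil-1/2) closes atlas CELLS outright and
files no `B`; the type-III(1) fourfold cell is `Ring2AbelianAllTypeIIIFourfolds`.

## §3 The unconditional Hasse diagram (kernel edges; `h₂₁` marked), theorem `ladder`

`FlatSectionsAlgebraic ⟹ VHC ⟹ (1) ⟹ (2) ⟹ (3) ⟹ (4) ⟹[h₂₁] (T∃) ⟹ CMToAbelian`, `(3) ⟹ (R631) ⟹[h₂₁] (T∃)`
(`cmAnchoredPencilTransport_of_andre1996_of_cmAnchoredPencilVHC`, NEW: deform's R_{6.3.1} placed in André II's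
chain), `(L∀) ⟹ (L) ⟹ (4)`, `(L∀) ⟹ (2)`. Neither of `(4) ⟹ (R631)`, `(R631) ⟹ (4)` is in the tree ((4): out
of a CM fibre on EVERY compact pencil; (R631): full transport on the 6.3.1-pencils only; deform VI
`cmAnchoredPencilVHC_iff_cmPointed_twiceDim` compares (R631) with (3) in relative dimension `2g`). Under `HC_CM`
(mod `h₂₁`) all of (2)–(4), (R631), (T∃) coincide with `HC_AV` (§1 (c), `collapse_of_andre1996_of_HC_CM`); mod
Lemmes 6.3.1–6.3.3 `(2) ⟺ (1)` (deform IV). OPEN without `HC_CM` and claimed nowhere in the cell: the converses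
`(T∃) ⟹ (4) ⟹ (3) ⟹ (2)`, `(L) ⟹ (L∀)`, `(1) ⟹ VHC`, and `CMToAbelian ⟹ (T∃)`.

References (bib keys): Andre1996Motifs (Lemme 6.3.1 p. 31, Lemmes 6.3.2–6.3.3 pp. 32–33, Remarque 2 p. 33);
Abdulali1994FamiliesAV ((1.1) p. 1122, Lemma 6.2 p. 1131); Deligne1982HodgeCycles (Prop. 6.1; Milne's
re-edition endnote 19); CharlesSchnell2014Notes (Conj. 11.3.1, Cor. 11.3.6, Thm. 11.5.11); Milne2020HodgeClassesAV
(Prop. 1, Rem. 2–3); Grothendieck1966 (footnote 13).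
-/

set_option linter.dupNamespace false

namespace Summit.HodgeConjecture.HodgeConjecture.Ring2.AbelianAll

open CategoryTheory
open Literature.AlgebraicGeometry Literature.AlgebraicGeometry.Motives
open Literature.AlgebraicGeometry.HodgeTheory
open Literature.AlgebraicGeometry.Andre1996 (andre1996_cmAnchoredPencil
  andre1996_cmHodgeClasses_algebraicallyAnchoredPencils)
open Literature.AlgebraicGeometry.Deligne1982 (cmLocus)
open Summit.HodgeConjecture.HodgeConjecture
open Summit.HodgeConjecture.HodgeConjecture.Theses
open Summit.HodgeConjecture.HodgeConjecture.Theses.RankFourFaces (CMAbelianHodge CMToAbelian)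
open Summit.HodgeConjecture.HodgeConjecture.Theses.PadicSemiregularLift (HodgeAbelianVarieties)

/-! ## §0 The grammar -/

/-- `B` is a SUFFICIENT complement of `HC_CM`: `HC_CM → B → HC_AV`. A definition. [folklore] -/
def ClosesWithCM (B : Prop) : Prop := CMAbelianHodge → B → HodgeAbelianVarieties

/-- `B` is NECESSARY (on-path from the target): `HC_AV → B`. A definition. [folklore] -/
def OnPathAV (B : Prop) : Prop := HodgeAbelianVarieties → B

/-- `B` is an EXACT complement of `HC_CM`: `HC_AV ↔ HC_CM ∧ B`. A definition. [folklore] -/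
def ExactWithCM (B : Prop) : Prop := HodgeAbelianVarieties ↔ (CMAbelianHodge ∧ B)

/-- `HC_CM` is IDLE next to `B`: `B → HC_AV` with no `HC_CM`. A definition (the "KIND 1" column). [folklore] -/
def CMIdle (B : Prop) : Prop := B → HodgeAbelianVarieties

/-- The `HC_CM`-relativisation of `B`: `HC_CM → B`. A definition. [folklore] -/
def ModCM (B : Prop) : Prop := CMAbelianHodge → B

/-! ## §1 (a) Order -/

/-- `ClosesWithCM` is antitone: a stronger statement closes if a weaker one does. [folklore] -/
theorem closesWithCM_antitone {B B' : Prop} (h : B' → B) (hB : ClosesWithCM B) : ClosesWithCM B' :=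
  fun hCM hB' ↦ hB hCM (h hB')

/-- `OnPathAV` is monotone. [folklore] -/
theorem onPathAV_monotone {B B' : Prop} (h : B → B') (hB : OnPathAV B) : OnPathAV B' :=
  fun hAV ↦ h (hB hAV)

/-- `CMIdle` is antitone. [folklore] -/
theorem cmIdle_antitone {B B' : Prop} (h : B' → B) (hB : CMIdle B) : CMIdle B' :=
  fun hB' ↦ hB (h hB')

/-- An idle-making `B` closes (with `HC_CM` unused). [folklore] -/
theorem closesWithCM_of_cmIdle {B : Prop} (h : CMIdle B) : ClosesWithCM B :=
  fun _ hB ↦ h hB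

/-- Exact = sufficient ∧ necessary (`HC_AV → HC_CM` is deform's `HC_CM_of_HC_AV`). [folklore] -/
theorem exactWithCM_iff {B : Prop} : ExactWithCM B ↔ ClosesWithCM B ∧ OnPathAV B :=
  ⟨fun h ↦ ⟨fun hCM hB ↦ h.2 ⟨hCM, hB⟩, fun hAV ↦ (h.1 hAV).2⟩,
    fun h ↦ ⟨fun hAV ↦ ⟨Ring2.Deform.HC_CM_of_HC_AV hAV, h.2 hAV⟩, fun hp ↦ h.1 hp.1 hp.2⟩⟩

/-- Conjunction: closing needs one conjunct to close, on-path needs both on-path. [folklore] -/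
theorem closesWithCM_and_left {B B' : Prop} (h : ClosesWithCM B) : ClosesWithCM (B ∧ B') :=
  closesWithCM_antitone And.left h

/-- [folklore] -/
theorem onPathAV_and {B B' : Prop} (h : OnPathAV B) (h' : OnPathAV B') : OnPathAV (B ∧ B') :=
  fun hAV ↦ ⟨h hAV, h' hAV⟩

/-- ON-PATH from the summit: every `OnPathAV` node follows from the Hodge conjecture. [folklore] -/
theorem of_onPathAV_of_hodgeConjecture {B : Prop} (h : OnPathAV B) (hHC : _root_.HodgeConjecture) : B :=
  h (Ring2.Deform.HC_AV_of_hodgeConjecture hHC)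

/-! ## §1 (b) The least element: the item `CMToAbelian` -/

/-- **`ClosesWithCM B ↔ (B → CMToAbelian)`**: a statement is a sufficient complement of `HC_CM` iff it implies
the route item stmt-16267 (`HC_AV ↔ HC_CM ∧ CMToAbelian`, the tree's CMPivot iff, by name through
`Hypotheses.hc_av_iff_hc_cm_and_cmToAbelian`). [folklore] -/
theorem closesWithCM_iff_imp_cmToAbelian {B : Prop} : ClosesWithCM B ↔ (B → CMToAbelian) :=
  ⟨fun h hB hCM A _ ↦ h hCM hB A,
    fun h hCM hB ↦ Hypotheses.hc_av_iff_hc_cm_and_cmToAbelian.2 ⟨hCM, h hB⟩⟩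

/-- The item closes. [folklore] -/
theorem closesWithCM_cmToAbelian : ClosesWithCM CMToAbelian :=
  closesWithCM_iff_imp_cmToAbelian.2 id

/-- The item is on-path. [folklore] -/
theorem onPathAV_cmToAbelian : OnPathAV CMToAbelian :=
  fun h ↦ (Hypotheses.hc_av_iff_hc_cm_and_cmToAbelian.1 h).2

/-- The item is exact (= the CMPivot iff). [folklore] -/
theorem exactWithCM_cmToAbelian : ExactWithCM CMToAbelian :=
  Hypotheses.hc_av_iff_hc_cm_and_cmToAbelian

/-- **LEAST ELEMENT**: every sufficient complement implies the item. [folklore] -/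
theorem cmToAbelian_of_closesWithCM {B : Prop} (h : ClosesWithCM B) (hB : B) : CMToAbelian :=
  closesWithCM_iff_imp_cmToAbelian.1 h hB

/-! ## §1 (c) Collapse modulo `HC_CM` -/

/-- Under `HC_CM`, any two exact complements are equivalent (both are then `HC_AV`). [folklore] -/
theorem iff_of_exactWithCM_of_HC_CM {B B' : Prop} (h : ExactWithCM B) (h' : ExactWithCM B')
    (hCM : CMAbelianHodge) : B ↔ B' :=
  ⟨fun hB ↦ (h'.1 (h.2 ⟨hCM, hB⟩)).2, fun hB' ↦ (h.1 (h'.2 ⟨hCM, hB'⟩)).2⟩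

/-- Under `HC_CM`, an exact complement IS the target. [folklore] -/
theorem iff_HC_AV_of_exactWithCM_of_HC_CM {B : Prop} (h : ExactWithCM B) (hCM : CMAbelianHodge) :
    B ↔ HodgeAbelianVarieties :=
  ⟨fun hB ↦ h.2 ⟨hCM, hB⟩, fun hAV ↦ (h.1 hAV).2⟩

/-- **Relativised to `HC_CM` there is ONE complement**: for every exact `B`, `(HC_CM → B) ↔ CMToAbelian`.
(Instances in the tree: deform VI `cmToAbelian_iff_HC_CM_imp_cmAnchoredPencilVHC`, André I
`cmToAbelian_iff_HC_CM_imp_cmAnchoredTransport`, each modulo `h₂₁` because exactness is.) [folklore] -/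
theorem modCM_iff_cmToAbelian_of_exactWithCM {B : Prop} (h : ExactWithCM B) : ModCM B ↔ CMToAbelian :=
  ⟨fun hB hCM A _ ↦ h.2 ⟨hCM, hB hCM⟩ A,
    fun hT hCM ↦ (h.1 (Hypotheses.hc_av_iff_hc_cm_and_cmToAbelian.2 ⟨hCM, hT⟩)).2⟩

/-- Relativisation does not change closing. [folklore] -/
theorem closesWithCM_modCM_iff {B : Prop} : ClosesWithCM (ModCM B) ↔ ClosesWithCM B :=
  ⟨fun h hCM hB ↦ h hCM (fun _ ↦ hB), fun h hCM hB ↦ h hCM (hB hCM)⟩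

/-- Every sufficient complement implies the relativisation of every necessary one. [folklore] -/
theorem modCM_of_closesWithCM_of_onPathAV {B B' : Prop} (h : ClosesWithCM B) (h' : OnPathAV B') (hB : B) :
    ModCM B' :=
  fun hCM ↦ h' (h hCM hB)

/-! ## §1 (d) The class axis -/

/-- **A sufficient complement closes every class target under `HC_CM`**:
`ClosesWithCM B ↔ (B → ∀ 𝒞, HC_CM → HCOnClass 𝒞)` (typer1's `cmToAbelian_iff_forall_hcOnClass_of_hcCM`). [folklore] -/
theorem closesWithCM_iff_forall_hcOnClass {B : Prop} :
    ClosesWithCM B ↔ (B → ∀ 𝒞 : AbelianVariety ℂ → Prop, CMAbelianHodge → ClassTargets.HCOnClass 𝒞) :=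
  closesWithCM_iff_imp_cmToAbelian.trans
    (imp_congr_right fun _ ↦ ClassTargets.cmToAbelian_iff_forall_hcOnClass_of_hcCM)

/-- The generic conditional cell: `HC_CM → B → HC_⟨𝒞⟩` for a closing `B`. [folklore] -/
theorem hcOnClass_of_closesWithCM {B : Prop} (h : ClosesWithCM B) (hCM : CMAbelianHodge) (hB : B)
    (𝒞 : AbelianVariety ℂ → Prop) : ClassTargets.HCOnClass 𝒞 :=
  ClassTargets.hcOnClass_of_hodgeAbelianVarieties 𝒞 (h hCM hB)

/-! ## §2 Instances by name -/

/-- (1) closes, mod the printed Mumford–Tate CM anchors (hypotheses I). [cite: CharlesSchnell2014Notes, Thm. 11.5.11] -/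
theorem closesWithCM_abelianSchemeVHC_of_mumfordTate (hAn : Hypotheses.MumfordTateCMAnchors) :
    ClosesWithCM Hypotheses.AbelianSchemeVHC :=
  fun hCM hV ↦ Hypotheses.hc_av_of_hc_cm_of_mumfordTateCMAnchors_of_abelianSchemeVHC hCM hAn hV

/-- (2) closes, mod Lemme 6.3.1 (deform IV row V′). [cite: Andre1996Motifs, Lemme 6.3.1 (p. 31)] -/
theorem closesWithCM_compactAbelianPencilVHC_of_andre1996 (h₂₁ : andre1996_cmAnchoredPencil) :
    ClosesWithCM Ring2.Deform.CompactAbelianPencilVHC :=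
  fun hCM hV ↦ Ring2.Deform.HC_AV_of_andre1996_of_HC_CM_of_compactAbelianPencilVHC h₂₁ hCM hV

/-- (1) closes, mod Lemme 6.3.1 (through (2)). [cite: Andre1996Motifs, §6.3 Remarque 2 (p. 33)] -/
theorem closesWithCM_abelianSchemeVHC_of_andre1996 (h₂₁ : andre1996_cmAnchoredPencil) :
    ClosesWithCM Hypotheses.AbelianSchemeVHC :=
  closesWithCM_antitone Ring2.Deform.compactAbelianPencilVHC_of_abelianSchemeVHC
    (closesWithCM_compactAbelianPencilVHC_of_andre1996 h₂₁)

/-- `VHC` (item 1076) closes, mod Lemme 6.3.1. [cite: Grothendieck1966, footnote 13] -/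
theorem closesWithCM_vhc_of_andre1996 (h₂₁ : andre1996_cmAnchoredPencil) :
    ClosesWithCM AnchorTransport.VariationalHodge :=
  closesWithCM_antitone Hypotheses.abelianSchemeVHC_of_vhc (closesWithCM_abelianSchemeVHC_of_andre1996 h₂₁)

/-- `FlatSectionsAlgebraic` closes, mod Lemme 6.3.1. [cite: CharlesSchnell2014Notes, Conj. 11.3.1] -/
theorem closesWithCM_flatSectionsAlgebraic_of_andre1996 (h₂₁ : andre1996_cmAnchoredPencil) :
    ClosesWithCM Hypotheses.FlatSectionsAlgebraic :=
  closesWithCM_antitone Hypotheses.vhc_of_flatSectionsAlgebraic (closesWithCM_vhc_of_andre1996 h₂₁)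

/-- (1), (2) are on-path. [cite: CharlesSchnell2014Notes, Cor. 11.3.6 (p. 494)] -/
theorem onPathAV_abelianSchemeVHC_and_compactAbelianPencilVHC :
    OnPathAV Hypotheses.AbelianSchemeVHC ∧ OnPathAV Ring2.Deform.CompactAbelianPencilVHC :=
  ⟨Hypotheses.abelianSchemeVHC_of_hc_av, Ring2.Deform.compactAbelianPencilVHC_of_HC_AV⟩

/-- KIND 1 in the kernel: `HC_CM` is IDLE next to `FlatSectionsAlgebraic`, `VHC`, (1), (2), (L∀), granted
Lemmes 6.3.1–6.3.3 (deform IV (M′)). [cite: Andre1996Motifs, §6.3 (pp. 31–33)] [cite: Milne2020HodgeClassesAV, Rem. 2–3] -/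
theorem cmIdle_blanket_of_andre1996 (h₂₁ : andre1996_cmAnchoredPencil)
    (h₂₂ : andre1996_cmHodgeClasses_algebraicallyAnchoredPencils) :
    CMIdle Hypotheses.FlatSectionsAlgebraic ∧ CMIdle AnchorTransport.VariationalHodge ∧
      CMIdle Hypotheses.AbelianSchemeVHC ∧ CMIdle Ring2.Deform.CompactAbelianPencilVHC ∧
      CMIdle AlgebraicFixedPart :=
  have h2 : CMIdle Ring2.Deform.CompactAbelianPencilVHC :=
    Ring2.Deform.HC_AV_of_andre1996_of_compactAbelianPencilVHC h₂₁ h₂₂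
  have h1 : CMIdle Hypotheses.AbelianSchemeVHC :=
    cmIdle_antitone Ring2.Deform.compactAbelianPencilVHC_of_abelianSchemeVHC h2
  have hV : CMIdle AnchorTransport.VariationalHodge := cmIdle_antitone Hypotheses.abelianSchemeVHC_of_vhc h1
  ⟨cmIdle_antitone Hypotheses.vhc_of_flatSectionsAlgebraic hV, hV, h1, h2,
    cmIdle_antitone compactAbelianPencilVHC_of_algebraicFixedPart h2⟩

/-- **DEDUP (LEAD ruling, kernel): André I's (3) `CMPointedPencilVHC` IS deform VI's `CMPointedCompactPencilVHC`**
(a point of `cmLocus f d` is a CM fibre presented by an abelian variety, whose dimension clause is automatic on a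
compact pencil, André I `mem_cmLocus_of_compactPencil`). Count once. [cite: Deligne1982HodgeCycles, §6 proof of Prop. 6.1] -/
theorem cmPointedPencilVHC_iff_deform : CMPointedPencilVHC ↔ Ring2.Deform.CMPointedCompactPencilVHC := by
  constructor
  · intro h d 𝒳 S f hf hex
    obtain ⟨t, A₀, ⟨e₀⟩, hA₀⟩ := hex
    exact h f hf ⟨t, mem_cmLocus_of_compactPencil hf e₀ hA₀⟩
  · intro h d 𝒳 S f hf hne
    obtain ⟨t, A₀, he, -, hA₀⟩ := hne
    exact h f hf ⟨t, A₀, he, hA₀⟩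

/-- (3), (R631), (4), (L) close mod Lemme 6.3.1; (T∃) closes with NO named fact (André II).
[cite: Andre1996Motifs, Lemme 6.3.1 (p. 31) and §6.3 a) (p. 33)] [cite: Abdulali1994FamiliesAV, Lemma 6.2 (p. 1131)] -/
theorem closesWithCM_cmLocalised_of_andre1996 (h₂₁ : andre1996_cmAnchoredPencil) :
    ClosesWithCM Ring2.Deform.CMPointedCompactPencilVHC ∧ ClosesWithCM Ring2.Deform.CMAnchoredPencilVHC ∧
      ClosesWithCM CMAnchoredTransport ∧ ClosesWithCM CMFibreAlgebraicLift :=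
  ⟨fun hCM hV ↦ Ring2.Deform.HC_AV_of_andre1996_of_HC_CM_of_cmPointedCompactPencilVHC h₂₁ hCM hV,
    fun hCM hR ↦ Ring2.Deform.HC_AV_of_andre1996_of_HC_CM_of_cmAnchoredPencilVHC h₂₁ hCM hR,
    fun hCM hB ↦ HC_AV_of_HC_CM_and_Bmin h₂₁ hCM hB,
    fun hCM hL ↦ HC_AV_of_HC_CM_and_cmFibreAlgebraicLift h₂₁ hCM hL⟩

/-- **(T∃) closes with NO named fact** (André II `HC_AV_of_HC_CM_and_cmAnchoredPencilTransport`).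
[cite: Andre1996Motifs, §6.3 a) (p. 33)] -/
theorem closesWithCM_cmAnchoredPencilTransport : ClosesWithCM CMAnchoredPencilTransport :=
  fun hCM hT ↦ HC_AV_of_HC_CM_and_cmAnchoredPencilTransport hCM hT

/-- Hence **(T∃) ⟹ CMToAbelian unconditionally** (least element; no fact, no `HC_CM`). [folklore] -/
theorem cmToAbelian_of_cmAnchoredPencilTransport (hT : CMAnchoredPencilTransport) : CMToAbelian :=
  cmToAbelian_of_closesWithCM closesWithCM_cmAnchoredPencilTransport hT

/-- (3), (R631), (4) are on-path; (T∃) is on-path mod Lemme 6.3.1. [cite: CharlesSchnell2014Notes, Cor. 11.3.6 (p. 494)] -/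
theorem onPathAV_cmLocalised (h₂₁ : andre1996_cmAnchoredPencil) :
    OnPathAV Ring2.Deform.CMPointedCompactPencilVHC ∧ OnPathAV Ring2.Deform.CMAnchoredPencilVHC ∧
      OnPathAV CMAnchoredTransport ∧ OnPathAV CMAnchoredPencilTransport :=
  ⟨Ring2.Deform.cmPointedCompactPencilVHC_of_HC_AV, Ring2.Deform.cmAnchoredPencilVHC_of_HC_AV,
    cmAnchoredTransport_of_HC_AV, cmAnchoredPencilTransport_of_andre1996_of_HC_AV h₂₁⟩

/-- Exactness of (2), (3), (R631), (4), (T∃) mod Lemme 6.3.1, in the grammar (all by name). [cite: Andre1996Motifs, Lemme 6.3.1 and Remarque 2 (pp. 31–33)] -/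
theorem exactWithCM_candidates_of_andre1996 (h₂₁ : andre1996_cmAnchoredPencil) :
    ExactWithCM Ring2.Deform.CompactAbelianPencilVHC ∧ ExactWithCM Ring2.Deform.CMPointedCompactPencilVHC ∧
      ExactWithCM Ring2.Deform.CMAnchoredPencilVHC ∧ ExactWithCM CMAnchoredTransport ∧
      ExactWithCM CMAnchoredPencilTransport :=
  ⟨Ring2.Deform.HC_AV_iff_HC_CM_and_compactAbelianPencilVHC_of_andre1996 h₂₁,
    Ring2.Deform.HC_AV_iff_HC_CM_and_cmPointedCompactPencilVHC_of_andre1996 h₂₁,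
    Ring2.Deform.HC_AV_iff_HC_CM_and_cmAnchoredPencilVHC_of_andre1996 h₂₁,
    HC_AV_iff_HC_CM_and_cmAnchoredTransport h₂₁, HC_AV_iff_HC_CM_and_cmAnchoredPencilTransport h₂₁⟩

/-- Hence mod Lemme 6.3.1: `(HC_CM → T∃) ↔ CMToAbelian` — the item IS "under `HC_CM`, some CM-anchored compact
pencil through each Hodge class transports algebraicity out of its CM fibres". [cite: Andre1996Motifs, Lemme 6.3.1 (p. 31)] -/
theorem modCM_cmAnchoredPencilTransport_iff_cmToAbelian (h₂₁ : andre1996_cmAnchoredPencil) :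
    ModCM CMAnchoredPencilTransport ↔ CMToAbelian :=
  modCM_iff_cmToAbelian_of_exactWithCM (exactWithCM_candidates_of_andre1996 h₂₁).2.2.2.2

/-! ## §3 The unconditional Hasse diagram -/

/-- **NEW EDGE: (R631) ∧ Lemme 6.3.1 ⟹ (T∃)** — deform VI's transport along the 6.3.1-pencils, read on the pencil
that Lemme 6.3.1 supplies, is André II's existential node (transport out of the CM fibre `t` is the instance
`s₀ := t` of `InvariantCyclesHoldFor`). [cite: Andre1996Motifs, Lemme 6.3.1 (p. 31)] -/
theorem cmAnchoredPencilTransport_of_andre1996_of_cmAnchoredPencilVHC (h₂₁ : andre1996_cmAnchoredPencil)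
    (hR : Ring2.Deform.CMAnchoredPencilVHC) : CMAnchoredPencilTransport := by
  intro A hA p c hc hpp
  obtain ⟨𝒳, S, f, hf⟩ := h₂₁ A hA p c hc hpp
  exact ⟨𝒳, S, f, hf, fun p' W hW t _ h₀ s ↦ hR A p c f hf p' W hW ⟨t, h₀⟩ s⟩

/-- **The ladder, strongest to weakest, every arrow a landed theorem** (`h₂₁` = Lemme 6.3.1 where marked in §3 of
the header): `FlatSectionsAlgebraic ⟹ VHC ⟹ (1) ⟹ (2) ⟹ (3) ⟹ (4) ⟹ (T∃) ⟹ CMToAbelian`, `(3) ⟹ (R631) ⟹ (T∃)`,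
`(L∀) ⟹ (L) ⟹ (4)`, `(L∀) ⟹ (2)`. No converse is claimed. [cite: Andre1996Motifs, §6.3 (pp. 31–33)]
[cite: CharlesSchnell2014Notes, Conj. 11.3.1] -/
theorem ladder (h₂₁ : andre1996_cmAnchoredPencil) :
    (Hypotheses.FlatSectionsAlgebraic → AnchorTransport.VariationalHodge) ∧
      (AnchorTransport.VariationalHodge → Hypotheses.AbelianSchemeVHC) ∧
      (Hypotheses.AbelianSchemeVHC → Ring2.Deform.CompactAbelianPencilVHC) ∧
      (Ring2.Deform.CompactAbelianPencilVHC → Ring2.Deform.CMPointedCompactPencilVHC) ∧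
      (Ring2.Deform.CMPointedCompactPencilVHC → CMAnchoredTransport) ∧
      (CMAnchoredTransport → CMAnchoredPencilTransport) ∧
      (CMAnchoredPencilTransport → CMToAbelian) ∧
      (Ring2.Deform.CMPointedCompactPencilVHC → Ring2.Deform.CMAnchoredPencilVHC) ∧
      (Ring2.Deform.CMAnchoredPencilVHC → CMAnchoredPencilTransport) ∧
      (AlgebraicFixedPart → CMFibreAlgebraicLift) ∧ (CMFibreAlgebraicLift → CMAnchoredTransport) ∧
      (AlgebraicFixedPart → Ring2.Deform.CompactAbelianPencilVHC) :=
  ⟨Hypotheses.vhc_of_flatSectionsAlgebraic, Hypotheses.abelianSchemeVHC_of_vhc,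
    Ring2.Deform.compactAbelianPencilVHC_of_abelianSchemeVHC,
    Ring2.Deform.cmPointedCompactPencilVHC_of_compactAbelianPencilVHC,
    fun h ↦ cmAnchoredTransport_of_cmPointedPencilVHC (cmPointedPencilVHC_iff_deform.2 h),
    cmAnchoredPencilTransport_of_andre1996_of_cmAnchoredTransport h₂₁,
    cmToAbelian_of_cmAnchoredPencilTransport,
    Ring2.Deform.cmAnchoredPencilVHC_of_cmPointedCompactPencilVHC,
    cmAnchoredPencilTransport_of_andre1996_of_cmAnchoredPencilVHC h₂₁,
    cmFibreAlgebraicLift_of_algebraicFixedPart, cmAnchoredTransport_of_cmFibreAlgebraicLift,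
    compactAbelianPencilVHC_of_algebraicFixedPart⟩

/-- **Under `HC_CM` (mod Lemme 6.3.1) the whole CM-localised segment collapses onto `HC_AV`**: (2), (3), (R631),
(4), (T∃) are pairwise equivalent (§1 (c) applied to `exactWithCM_candidates_of_andre1996`). The open converses
of §3 are open only in the absence of `HC_CM`. [cite: Andre1996Motifs, Remarque 2 (p. 33)] -/
theorem collapse_of_andre1996_of_HC_CM (h₂₁ : andre1996_cmAnchoredPencil) (hCM : CMAbelianHodge) :
    (CMAnchoredPencilTransport ↔ Ring2.Deform.CompactAbelianPencilVHC) ∧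
      (CMAnchoredPencilTransport ↔ Ring2.Deform.CMAnchoredPencilVHC) ∧
      (CMAnchoredTransport ↔ Ring2.Deform.CMAnchoredPencilVHC) :=
  have h := exactWithCM_candidates_of_andre1996 h₂₁
  ⟨iff_of_exactWithCM_of_HC_CM h.2.2.2.2 h.1 hCM, iff_of_exactWithCM_of_HC_CM h.2.2.2.2 h.2.2.1 hCM,
    iff_of_exactWithCM_of_HC_CM h.2.2.2.1 h.2.2.1 hCM⟩

/-! ## Audit

Every theorem above with conclusion `HC_AV`, `HC_CM`, `CMToAbelian` or a candidate has an OPEN statement among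
its hypotheses; the defs of §0 are predicates; `HC_CM` occurs only as the binder inside `ClosesWithCM` /
`ExactWithCM` / `ModCM` or as an explicit hypothesis `hCM`. Nothing is decided. -/

/-- On-path audit of the frame: the summit gives every node of the ladder except the cycle-theoretic (L), (L∀)
and the Lefschetz rows (which follow from the summit only through Kleiman's fact, André II). [folklore] -/
theorem ladder_of_hodgeConjecture (h₂₁ : andre1996_cmAnchoredPencil) (hHC : _root_.HodgeConjecture) :
    Hypotheses.FlatSectionsAlgebraic ∧ Ring2.Deform.CMAnchoredPencilVHC ∧ CMAnchoredPencilTransport ∧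
      CMToAbelian :=
  ⟨Hypotheses.flatSectionsAlgebraic_of_hodgeConjecture hHC,
    of_onPathAV_of_hodgeConjecture (onPathAV_cmLocalised h₂₁).2.1 hHC,
    of_onPathAV_of_hodgeConjecture (onPathAV_cmLocalised h₂₁).2.2.2 hHC,
    of_onPathAV_of_hodgeConjecture onPathAV_cmToAbelian hHC⟩

end Summit.HodgeConjecture.HodgeConjecture.Ring2.AbelianAll
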